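import Literature.MathematicalPhysics.QuantumFieldTheory.ConformalBootstrap3D.PointKernelLowerV3Sigma
import Literature.MathematicalPhysics.QuantumFieldTheory.ConformalBootstrap3D.PointKernelTMCell

/-!
# LOWER-box kernel theorem, v3, σ-form, with a CLOSED ε-top

The global enclosure programme states its lower boxes CLOSED in `Δ_ε`
(`GlobalEnclosure.GlobalCertificates17.lower_0515_0520 : SigmaBoxExcluded (Icc 0.515 0.520 ×ˢ Icc 0.6 0.95)`),
while the kernel's cell format is half-open (`PCert.V3Block … : ∀ Δ ∈ Ico a b, BlockPositive …`, box `QBoxL`).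
The Taylor models of a kernel-v3 cell are valid on the CLOSED range `[A - h, A + h]`; the half-open conclusion
only serves the irregular points (blocks defined by continuity from the right).  At `ℓ = 0` every `Δ > 1/2` is
regular (`isRegularPoint3D_of_le_two`), so the last `ε`-cell also certifies its right endpoint.  This file
threads that endpoint through the chain:

* `blockPositive_pointFunctional_of_headG_Icc`, `cell_of_headG_pieces_Icc`, `PKTM.blockPositive_of_cellPass_Icc`
  — closed-cell / regular-point versions of the landed `…_Ico` / `cell_of_headG_pieces` /
  `PKTM.blockPositive_of_cellPass` (proofs verbatim: the regular-point half of the originals);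
* `PointKernel.QBoxLC`, `PCert.V3Top` — the closed box and the endpoint cell fact;
* `sigmaBoxExcluded_of_pointCellsC` — `sigmaBoxExcluded_of_pointCells` with closed ε-top (+ `htopε`);
* `PCert.sigmaBoxExcluded_of_kernelV3MC` — `PCert.sigmaBoxExcluded_of_kernelV3M` on `QBoxLC` (+ `htop`).

References: [cite: HogervorstRychkov2013, §3 eq. (3.6)], [cite: HogervorstRychkov2013, §3 eq. (3.9)];
single-correlator axioms [cite: KosPolandSimmonsduffin2014, §3.3 eq. (3.16)].  No new analysis.
-/

noncomputable section

namespace Literature.MathematicalPhysics.QuantumFieldTheory.ConformalBootstrap3D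

open Real Finset Set

/-! ### Closed-cell versions of the node-level head cell theorems -/

/-- **Closed-cell / regular-point version of `blockPositive_pointFunctional_of_headG_Ico`.** Same
hypotheses; conclusion at every REGULAR point of the CLOSED cell `[a, b]` (the `Ico` theorem is this at the
regular points plus continuity from the right at the irregular ones; here the right endpoint `b` is kept).
[cite: HogervorstRychkov2013, §3 eq. (3.9)] -/
theorem blockPositive_pointFunctional_of_headG_Icc {N : ℕ} (w z zb : Fin N → ℝ)
    (hz : ∀ k, z k ∈ Ioo (0 : ℝ) 1) (hzb : ∀ k, zb k ∈ Ioo (0 : ℝ) 1) {ℓ : ℕ} (nF : ℕ)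
    {a b σ δ s : ℝ} (hδ : 0 ≤ δ) (hbd : unitarityBound3D ℓ ≤ a) (hs : s ∈ Icc σ (σ + δ))
    (hpos : ∀ Δ ∈ Icc a b, unitarityBound3D ℓ < Δ → ∀ θ ∈ Icc (0 : ℝ) 1,
      0 ≤ headG w z zb ℓ nF σ δ 0 Δ + θ * headG w z zb ℓ nF σ δ 1 Δ +
        θ ^ 2 * headG w z zb ℓ nF σ δ 2 Δ)
    (htail : ∀ q : ℕ × ℕ, q ∉ headSet ℓ nF → InDescendantRange ℓ q.1 q.2 →
      ∀ E ∈ Icc (a + q.1) (b + q.1), 0 ≤ pointFunctional w z zb (crossF s (-1) (zMono E q.2))) :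
    ∀ Δ' ∈ Icc a b, IsRegularPoint3D Δ' ℓ → BlockPositive (pointFunctional w z zb) s Δ' ℓ := by
  intro Δ' hΔ' hr
  have hlt : unitarityBound3D ℓ < Δ' := lt_of_le_of_ne (hbd.trans hΔ'.1) (Ne.symm hr.1)
  obtain ⟨θ, hθ, hsθ⟩ := exists_boxCoord hs
  have hs' : σ + θ * δ = s := by rw [hsθ]; ring
  refine blockPositive_pointFunctional_of_termwise w z zb hz hzb hlt hr.2 (headSet ℓ nF) ?_ ?_
  · have hsum := (hpos Δ' hΔ' hlt θ hθ).trans (headG_quad_le w z zb hz hzb ℓ nF hδ hθ hlt)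
    rw [hs'] at hsum
    have hrw : ∑ q ∈ headSet ℓ nF, hrCoeff Δ' ℓ q.1 q.2 / legendreLam ℓ *
        pointFunctional w z zb (crossF s (-1) (zMono (Δ' + (q.1 : ℝ)) q.2)) =
        (1 / legendreLam ℓ) * ∑ q ∈ headSet ℓ nF, hrCoeff Δ' ℓ q.1 q.2 *
          pointFunctional w z zb (crossF s (-1) (zMono (Δ' + (q.1 : ℝ)) q.2)) := by
      rw [Finset.mul_sum]; exact Finset.sum_congr rfl (fun q _ => by ring)
    rw [hrw]
    have hlam : 0 < legendreLam ℓ := legendreLam_pos ℓ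
    exact mul_nonneg (by positivity) hsum
  · intro q hq hrq
    exact htail q hq hrq (Δ' + (q.1 : ℝ)) ⟨by linarith [hΔ'.1], by linarith [hΔ'.2]⟩

/-- **Closed-cell / regular-point version of `cell_of_headG_pieces`** (node-level head cell with
`s`-pieces, on a box): conclusion at every regular point of `[a, b]`. [cite: HogervorstRychkov2013, §3 eq. (3.9)] -/
theorem cell_of_headG_pieces_Icc {N : ℕ} (w z zb : Fin N → ℝ)
    (hz : ∀ k, z k ∈ Ioo (0 : ℝ) 1) (hzb : ∀ k, zb k ∈ Ioo (0 : ℝ) 1)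
    {Q : Set (ℝ × ℝ)} {slo shi E₀ τ : ℝ} (hQ : ∀ p ∈ Q, slo ≤ p.1 ∧ p.1 ≤ shi)
    (htail : ∀ (j : ℕ) (E : ℝ), E₀ ≤ E → (j : ℝ) + τ ≤ E → (j : ℝ) ≤ E → ∀ p ∈ Q,
      0 ≤ pointFunctional w z zb (crossF p.1 (-1) (zMono E j)))
    {ℓ : ℕ} {a b : ℝ} (nF : ℕ) (hnF : E₀ ≤ a + ((nF : ℝ) + 1))
    (hbd : unitarityBound3D ℓ ≤ a) (haτ : (ℓ : ℝ) + τ ≤ a)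
    (σ : ℕ → ℝ) (P : ℕ) (hP : 0 < P) (hσ0 : σ 0 = slo) (hσP : σ P = shi)
    (hσ : ∀ i < P, σ i ≤ σ (i + 1))
    (hpos : ∀ i < P, ∀ Δ ∈ Icc a b, unitarityBound3D ℓ < Δ → ∀ θ ∈ Icc (0 : ℝ) 1,
      0 ≤ headG w z zb ℓ nF (σ i) (σ (i + 1) - σ i) 0 Δ
        + θ * headG w z zb ℓ nF (σ i) (σ (i + 1) - σ i) 1 Δ
        + θ ^ 2 * headG w z zb ℓ nF (σ i) (σ (i + 1) - σ i) 2 Δ) :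
    ∀ p ∈ Q, ∀ Δ ∈ Icc a b, IsRegularPoint3D Δ ℓ → BlockPositive (pointFunctional w z zb) p.1 Δ ℓ := by
  intro p hp Δ hΔ hr
  obtain ⟨i, hi, hsi⟩ := exists_piece_Icc σ P hP p.1
    ⟨by rw [hσ0]; exact (hQ p hp).1, by rw [hσP]; exact (hQ p hp).2⟩
  have hδ : 0 ≤ σ (i + 1) - σ i := sub_nonneg.2 (hσ i hi)
  have hsi' : p.1 ∈ Icc (σ i) (σ i + (σ (i + 1) - σ i)) := by
    rw [show σ i + (σ (i + 1) - σ i) = σ (i + 1) by ring]; exact hsi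
  refine blockPositive_pointFunctional_of_headG_Icc w z zb hz hzb nF hδ hbd hsi' (hpos i hi) ?_ Δ hΔ hr
  intro q hq hrq E hE
  have hE0 : E₀ ≤ E := by
    have := headSet_off hnF q hq hrq
    linarith [hE.1]
  have hj : (q.2 : ℝ) ≤ (ℓ : ℝ) + q.1 := by exact_mod_cast hrq.2.1
  have hjτ : (q.2 : ℝ) + τ ≤ E := by linarith [hE.1]
  have hjE : (q.2 : ℝ) ≤ E := by
    linarith [hE.1, natCast_add_half_le_unitarityBound3D ℓ]
  exact htail q.2 E hE0 hjτ hjE p hp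

namespace PKTM

open PointKernel

/-- **Closed-cell / regular-point version of `PKTM.blockPositive_of_cellPass`**: a passed kernel-v3 cell
gives block positivity at every REGULAR `Δ ∈ [a, b] ⊆ [A - h, A + h]` (in particular at the right endpoint of
the last `ε`-cell, `ℓ = 0`, `Δ > 1/2`). [cite: HogervorstRychkov2013, §3 eq. (3.6)] -/
theorem blockPositive_of_cellPass_Icc {c : PCert} (hc : c.checkNodes = true)
    {Q : Set (ℝ × ℝ)} {slo shi : ℚ} {E₀ τ : ℝ}
    (hQ : ∀ q ∈ Q, ((slo : ℚ) : ℝ) ≤ q.1 ∧ q.1 ≤ ((shi : ℚ) : ℝ))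
    (htail : ∀ (j : ℕ) (E : ℝ), E₀ ≤ E → (j : ℝ) + τ ≤ E → (j : ℝ) ≤ E → ∀ q ∈ Q,
      0 ≤ pointFunctional c.wR c.zR c.zbR (crossF q.1 (-1) (zMono E j)))
    {t : TMCell} (hD : 1 ≤ t.D) (hK : 0 < t.K) (hℓ : Even t.ℓ)
    (hpiv : HRTM.pivOK t.A t.ℓ t.e t.nF = true) (hrA : t.rA.ok = true)
    (hA : t.rA.expo c.rho = t.A / 2)
    {ps : List TMPiece} {P : ℕ} (hP : 0 < P) (hch : chainOK c ps P slo shi = true)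
    (hpass : ∀ i < P, CellPass c t (pc ps i))
    {a b : ℝ} (ha : (t.A : ℝ) - t.h ≤ a) (hb : b ≤ (t.A : ℝ) + t.h)
    (hnF : E₀ ≤ a + ((t.nF : ℝ) + 1)) (hbd : unitarityBound3D t.ℓ ≤ a)
    (haτ : (t.ℓ : ℝ) + τ ≤ a) :
    ∀ q ∈ Q, ∀ Δ ∈ Icc a b, IsRegularPoint3D Δ t.ℓ →
      BlockPositive (pointFunctional c.wR c.zR c.zbR) q.1 Δ t.ℓ := by
  simp only [chainOK, Bool.and_eq_true, decide_eq_true_eq, List.all_eq_true, List.mem_range] at hch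
  obtain ⟨⟨h0, hPσ⟩, hall⟩ := hch
  let σ : ℕ → ℝ := fun i => expoR c (pc ps i).rSig
  have hδ : ∀ i < P, σ (i + 1) - σ i = expoR c (pc ps i).rDel := by
    intro i hi
    obtain ⟨⟨⟨he, -⟩, -⟩, -⟩ := hall i hi
    simp only [σ, expoR, ← he]; push_cast; ring
  refine cell_of_headG_pieces_Icc c.wR c.zR c.zbR (zR_mem_Ioo hc) (zbR_mem_Ioo hc) hQ htail t.nF hnF
    hbd haτ σ P hP (by simp only [σ, expoR, h0]) (by simp only [σ, expoR, hPσ]) ?_ ?_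
  · intro i hi
    obtain ⟨⟨⟨-, hd⟩, -⟩, -⟩ := hall i hi
    have := hδ i hi
    have hd' : (0 : ℝ) ≤ expoR c (pc ps i).rDel := by unfold expoR; exact_mod_cast hd
    linarith
  · intro i hi Δ hΔ _ θ hθ
    obtain ⟨⟨⟨-, -⟩, hrS⟩, hrD⟩ := hall i hi
    obtain ⟨gs, hparts, hnum⟩ := hpass i hi
    rw [hδ i hi]
    exact headG_nonneg_of_cellNumber hc hD hK hℓ hpiv hrA hrS hrD hA hparts hnum Δ
      ⟨by linarith [hΔ.1], by linarith [hΔ.2]⟩ θ hθ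

end PKTM

/-! ### The closed lower box and the endpoint cell fact -/

namespace PointKernel

/-- The CLOSED lower box `[s_lo, s_hi] × [ε_lo, ε_hi]` in the `(Δ_σ, Δ_ε)` plane (cf. `QBoxL`, half-open in
`ε`). [cite: KosPolandSimmonsduffin2014, §3.3 eq. (3.16)] -/
def QBoxLC (slo shi εlo εhi : ℚ) : Set (ℝ × ℝ) :=
  {p | (((slo : ℚ) : ℝ) ≤ p.1 ∧ p.1 ≤ ((shi : ℚ) : ℝ)) ∧ (((εlo : ℚ) : ℝ) ≤ p.2 ∧ p.2 ≤ ((εhi : ℚ) : ℝ))}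

namespace PCert

variable (c : PCert)

/-- **A kernel-v3 endpoint fact.** Row `ℓ`, point `Δ`: for every box `Q` of `s`-range `[c.slo, c.shi]` on
which the tail terms are non-negative, the point functional of `c` is block-positive at `(s, Δ, ℓ)` for all
`s ∈ Q` — what `PKTM.blockPositive_of_cellPass_Icc` gives at a regular point of a passed cell (cf. `V3Block`):
the per-point positivity condition of the linear-functional method. [cite: HogervorstRychkov2013, §3 eq. (3.6)] -/
def V3Top (E₀ τ Δ : ℝ) (ℓ : ℕ) : Prop :=
  ∀ Q : Set (ℝ × ℝ), (∀ q ∈ Q, ((c.slo : ℚ) : ℝ) ≤ q.1 ∧ q.1 ≤ ((c.shi : ℚ) : ℝ)) →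
    (∀ (j : ℕ) (E : ℝ), E₀ ≤ E → (j : ℝ) + τ ≤ E → (j : ℝ) ≤ E → ∀ q ∈ Q,
      0 ≤ pointFunctional c.wR c.zR c.zbR (crossF q.1 (-1) (zMono E j))) →
    ∀ q ∈ Q, BlockPositive (pointFunctional c.wR c.zR c.zbR) q.1 Δ ℓ

end PCert

end PointKernel

/-! ### The two-row lower table with semantic head cells, σ-version, closed ε-top -/

/-- **σ-exclusion from cells, CLOSED ε-top.** As `sigmaBoxExcluded_of_pointCells` (two-row LOWER-box table
with semantic head cells, σ-form) but the box may contain its top `ε`-edge: `Q ⊆ [s_lo, s_hi] × ([ε_lo, ε_hi] ∪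
[t_{0,0}, E₀))`, at the price of one more hypothesis `htopε` — block positivity AT `Δ = ε_hi` (`ℓ = 0`) on `Q`
(from the last `ε`-cell's closed Taylor-model range, `PKTM.blockPositive_of_cellPass_Icc`).  Rule (O2) at a
point with `Δ_ε = ε_hi` is `htopε`; everything else verbatim. [cite: HogervorstRychkov2013, §3 eq. (3.6)] -/
theorem sigmaBoxExcluded_of_pointCellsC {N : ℕ} {w z zb : Fin N → ℝ}
    (hz : ∀ k, z k ∈ Ioo (0 : ℝ) 1) (hzb : ∀ k, zb k ∈ Ioo (0 : ℝ) 1) (hord : ∀ k, zb k ≤ z k)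
    (apex : Fin N) (hapex : 0 ≤ w apex) (qd qr : Fin N → ℝ) (hqd : ∀ k, 0 < qd k ∧ qd k ≤ 1)
    (hqr : ∀ k, 0 < qr k ∧ qr k ≤ 1)
    (hdomd : ∀ k, z k * zb k ≤ qd k ^ 2 * (z apex * zb apex) ∧ z k ≤ qd k * z apex)
    (hdomr : ∀ k, (1 - z k) * (1 - zb k) ≤ qr k ^ 2 * (z apex * zb apex) ∧
      1 - zb k ≤ qr k * z apex)
    {Q : Set (ℝ × ℝ)} {slo shi εlo εhi E₀ ET τ : ℝ}
    (t : ℕ → ℕ → ℝ) (K : ℕ → ℕ) (tε : ℕ → ℝ) (Kε : ℕ)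
    (hQ : ∀ p ∈ Q, (slo ≤ p.1 ∧ p.1 ≤ shi) ∧
      ((εlo ≤ p.2 ∧ p.2 ≤ εhi) ∨ (t 0 0 ≤ p.2 ∧ p.2 < E₀)))
    (L : ℕ) (hL : E₀ ≤ (L : ℝ) + 1) (hτ1 : τ ≤ 1) (hτ0 : τ ≤ E₀)
    -- (O1), on `Q` itself
    (hI : ∀ p ∈ Q, 0 < pointFunctional w z zb (crossF p.1 (-1) (fun _ _ => (1 : ℝ))))
    -- the rows
    (htε : tε 0 = εlo ∧ tε Kε = εhi)
    (ht0 : t 0 0 ≤ 3 ∧ t 0 (K 0) = E₀)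
    (htℓ : ∀ ℓ, Even ℓ → ℓ ≠ 0 → ℓ < L → t ℓ 0 = (ℓ : ℝ) + 1 ∧ t ℓ (K ℓ) = E₀)
    (hcellε : ∀ k < Kε, ∀ p ∈ Q,
      ∀ Δ ∈ Ico (tε k) (tε (k + 1)), BlockPositive (pointFunctional w z zb) p.1 Δ 0)
    -- the top of the ε-row: block positivity AT `Δ = εhi`
    (htopε : ∀ p ∈ Q, BlockPositive (pointFunctional w z zb) p.1 εhi 0)
    (hcell : ∀ ℓ, (ℓ = 0 ∨ (Even ℓ ∧ ℓ < L)) → ∀ k < K ℓ, ∀ p ∈ Q,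
      ∀ Δ ∈ Ico (t ℓ k) (t ℓ (k + 1)), BlockPositive (pointFunctional w z zb) p.1 Δ ℓ)
    -- (M), termwise
    (hM : ∀ (j : ℕ) (E : ℝ), E₀ ≤ E → E < ET → (j : ℝ) + τ ≤ E → ∀ p ∈ Q,
      0 ≤ pointFunctional w z zb (crossF p.1 (-1) (zMono E j)))
    -- (T)
    (hB : ∑ k ∈ univ.erase apex, |w k| * ((1 - z k) * (1 - zb k)) ^ slo * qd k ^ ET
          + ∑ k, |w k| * (z k * zb k) ^ slo * qr k ^ ET ≤
          w apex * ((1 - z apex) * (1 - zb apex)) ^ shi) :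
    SigmaBoxExcluded Q := by
  have hQ1 : ∀ p ∈ Q, slo ≤ p.1 ∧ p.1 ≤ shi := fun p hp => (hQ p hp).1
  refine sigmaBoxExcluded_of_pointRules_twistI hz hzb hord apex hapex qd qr hqd hqr hdomd hdomr hQ1 hτ1 hτ0
    hI ?_ ?_ ?_ hM hB
  · -- (O2): `Δ_ε` lies in the ε-row (below its top, or AT the top) or in the scalar row
    intro p hp
    rcases (hQ p hp).2 with hε | h0
    · rcases hε.2.lt_or_eq with hlt | heq
      · exact blockPositive_of_cells_Ico tε Kε hcellε p hp p.2 ⟨htε.1 ▸ hε.1, htε.2 ▸ hlt⟩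
      · rw [heq]; exact htopε p hp
    · exact blockPositive_of_cells_Ico (t 0) (K 0) (hcell 0 (Or.inl rfl)) p hp p.2
        ⟨h0.1, ht0.2 ▸ h0.2⟩
  · -- (O3)
    exact scalar_nonneg_of_cells (t 0) (K 0) ht0.1 ht0.2 (hcell 0 (Or.inl rfl))
  · -- (O4)
    exact spinning_nonneg_of_cells L hL t K (fun ℓ hev hℓ hℓL => (htℓ ℓ hev hℓ hℓL).1.le)
      (fun ℓ hev hℓ hℓL => (htℓ ℓ hev hℓ hℓL).2)
      (fun ℓ hev hℓ hℓL => hcell ℓ (Or.inr ⟨hev, hℓL⟩))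

/-! ### The kernel certificate theorem (v3, semantic (M)), σ-version, closed ε-top -/

namespace PointKernel

namespace PCert

variable {c : PCert}

/-- **The lower-box certificate theorem of the kernel, v3 head cells, semantic (M), σ-form, CLOSED
ε-top.** As `PCert.sigmaBoxExcluded_of_kernelV3M` on the closed box `QBoxLC s_lo s_hi ε_lo ε_hi =
[s_lo, s_hi] × [ε_lo, ε_hi]`, with one more kernel fact `htop : c.V3Top E₀ τ ε_hi 0` (block positivity at
`Δ = ε_hi`, from the last `ε`-cell by `PKTM.blockPositive_of_cellPass_Icc` + `isRegularPoint3D_of_le_two`).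
[cite: HogervorstRychkov2013, §3 eq. (3.6)] -/
theorem sigmaBoxExcluded_of_kernelV3MC (hc : c.checkNodes = true)
    (KI : ℕ) (σI : ℕ → ℚ) (hKI : 0 < KI) (hσI0 : σI 0 = c.slo) (hσIK : σI KI = c.shi)
    (hIrow : ∀ i < KI, ∀ s ∈ Icc ((σI i : ℚ) : ℝ) ((σI (i + 1) : ℚ) : ℝ),
      0 < pointFunctional c.wR c.zR c.zbR (crossF s (-1) (fun _ _ => (1 : ℝ))))
    (qd qr : List ℚ) (ET : ℕ) (hT : c.tOK qd qr ET = true)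
    (εlo εhi E0 τ : ℚ) (L : ℕ) (hτ1 : τ ≤ 1) (hτ0 : τ ≤ E0) (hL : E0 ≤ (L : ℚ) + 1)
    (hM : ∀ (j : ℕ) (E : ℝ), ((E0 : ℚ) : ℝ) ≤ E → E < ((ET : ℕ) : ℝ) → (j : ℝ) + ((τ : ℚ) : ℝ) ≤ E →
      ∀ p ∈ QBoxLC c.slo c.shi εlo εhi,
        0 ≤ pointFunctional c.wR c.zR c.zbR (crossF p.1 (-1) (zMono E j)))
    (t : ℕ → ℕ → ℝ) (K : ℕ → ℕ) (tε : ℕ → ℝ) (Kε : ℕ)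
    (htε : tε 0 = ((εlo : ℚ) : ℝ) ∧ tε Kε = ((εhi : ℚ) : ℝ))
    (ht0 : t 0 0 ≤ 3 ∧ t 0 (K 0) = ((E0 : ℚ) : ℝ))
    (htℓ : ∀ ℓ, Even ℓ → ℓ ≠ 0 → ℓ < L → t ℓ 0 = (ℓ : ℝ) + 1 ∧ t ℓ (K ℓ) = ((E0 : ℚ) : ℝ))
    (hcellε : ∀ k < Kε, c.V3Block ((E0 : ℚ) : ℝ) ((τ : ℚ) : ℝ) (tε k) (tε (k + 1)) 0)
    (hcell : ∀ ℓ, (ℓ = 0 ∨ (Even ℓ ∧ ℓ < L)) → ∀ k < K ℓ,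
      c.V3Block ((E0 : ℚ) : ℝ) ((τ : ℚ) : ℝ) (t ℓ k) (t ℓ (k + 1)) ℓ)
    (htop : c.V3Top ((E0 : ℚ) : ℝ) ((τ : ℚ) : ℝ) ((εhi : ℚ) : ℝ) 0) :
    SigmaBoxExcluded (QBoxLC c.slo c.shi εlo εhi) := by
  obtain ⟨hqd, hqr, hdomd, hdomr, hB⟩ := t_hyps hc qd qr ET hT
  have hz := zR_mem hc
  have hzb := zbR_mem hc
  have hord : ∀ k : Fin c.N, c.zbR k ≤ c.zR k := by
    intro k
    have hn := checkNode_of_checkNodes hc k.2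
    simpa [zR, zbR] using (show ((c.zb k : ℚ) : ℝ) ≤ ((c.z k : ℚ) : ℝ) by exact_mod_cast zb_le_z hn)
  have hapex : 0 ≤ c.wR ⟨c.apex, apex_lt hc⟩ := by
    simpa [wR] using (show ((0 : ℚ) : ℝ) ≤ ((c.w c.apex : ℚ) : ℝ) by exact_mod_cast w_apex_nonneg hc)
  have hQ1 : ∀ p ∈ QBoxLC c.slo c.shi εlo εhi, ((c.slo : ℚ) : ℝ) ≤ p.1 ∧ p.1 ≤ ((c.shi : ℚ) : ℝ) :=
    fun p hp => hp.1
  -- (O1) from the identity pieces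
  have hI : ∀ p ∈ QBoxLC c.slo c.shi εlo εhi,
      0 < pointFunctional c.wR c.zR c.zbR (crossF p.1 (-1) (fun _ _ => (1 : ℝ))) := by
    intro p hp
    obtain ⟨i, hi, hs⟩ := exists_piece_Icc (fun i => ((σI i : ℚ) : ℝ)) KI hKI p.1
      ⟨by simp only [hσI0]; exact hp.1.1, by simp only [hσIK]; exact hp.1.2⟩
    exact hIrow i hi p.1 hs
  -- the tail terms on the whole twist domain: (M) below `E_T`, (T) from `E_T` on
  have htail := tail_nonneg_of_pointRules_twist c.wR c.zR c.zbR hz hzb hord ⟨c.apex, apex_lt hc⟩ hapex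
    (c.qR qd) (c.qR qr) hqd hqr hdomd hdomr hQ1 hM hB
  exact sigmaBoxExcluded_of_pointCellsC hz hzb hord ⟨c.apex, apex_lt hc⟩ hapex (c.qR qd) (c.qR qr) hqd hqr
    hdomd hdomr t K tε Kε (fun p hp => ⟨hp.1, Or.inl hp.2⟩) L (by exact_mod_cast hL)
    (by exact_mod_cast hτ1) (by exact_mod_cast hτ0) hI htε ht0 htℓ
    (fun k hk p hp Δ hΔ => hcellε k hk _ hQ1 htail p hp Δ hΔ)
    (fun p hp => htop _ hQ1 htail p hp)
    (fun ℓ hℓ k hk p hp Δ hΔ => hcell ℓ hℓ k hk _ hQ1 htail p hp Δ hΔ) hM hB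

end PCert

end PointKernel

end Literature.MathematicalPhysics.QuantumFieldTheory.ConformalBootstrap3D
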